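import Summits.QuantumFields.YangMills.Theorems.ColdStartUniversalityLatticeLangevinBlockLoopStringMixing
import HarnessLib

/-!
# Route `ColdStartUniversality`, aside K_A1 `UniformColdStartMixing` (24809), LINE 4 «cold_entropy»: (ULS) ALONE ⇒ BLOCK-AVERAGED LOOP STRINGS
# EQUILIBRATE POINTWISE IN PHYSICAL TIME WITHIN `A + log(1/ε_K)/(2c)` — the crux's conclusion shape for smooth unit-block observables, up to a log

Helper file (seat `ym-line-csu-p1`, g28; `--supports stmt-QuantumFields-24809`).  Physical-time reading of `nearUniform_blockLoopString_coldStart_of_uniformLogSobolev`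
(`…BlockLoopStringMixing`): for a nonempty block `B` of base points (the crux: unit PHYSICAL blocks, `#B = ε_K⁻³`, so the number of blocks `N_K = L_K³/#B = ℓ³`
is FIXED) and rectangles `(i_k, j_k, R_k × T_k)`, `W̄_(B,k) = (#B)⁻¹Σ_(x∈B) W_(R_k×T_k)(x; i_k, j_k)`:
* ★★★ `nearUniform_blockLoopString_physicalTime_of_uniformLogSobolev` — (ULS) ⇒ `∃γ₁>0 ∀F, 0<γ≤γ₁ ⇒ ∃c>0 ∃K₀ ∀K≥K₀ ∀B ∀loops ∀δ>0`, every solution at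
  `β'_K` from any deterministic start, every physical time `s ≥ 2ε_K` with `2ε_K + log(C_K/δ)/(2c) ≤ s`:
  `|E ∏_k W̄_(B,k)(U(s/ε_K)) − ∫∏_k W̄_(B,k) dμ_K| ≤ δ`, `C_K = Σ_k(R_k+T_k)·√(16(366β'_K+3)·N_K/(cε_K))`;
* ★ `nearUniform_blockThreshold_le_log` — for `ε ≤ 1`, `γε ≤ 1`: `2ε + log(A√(16(366·(γε)⁻¹/2+3)·N/(cε))/δ)/(2c) ≤ 2 + (log(A/δ) + ½log(2976N/(γc)))/(2c)
  + log(1/ε)/(2c)` — with `N` fixed the ONLY cut-off dependence of the threshold is `log(1/ε_K)/(2c)` (plus `log(1/ε_K)/(2c)` more through `A = Σ_k(R_k+T_k) ≍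
  ε_K⁻¹` for loops of fixed PHYSICAL size).
PLANNER-FACING, HONEST: (ULS) is K-UNIFORM and OPEN; smooth `½Re tr` block averages, not Bałaban's `avgObs expMeanLogSU`; nothing K-uniform is proved; 24809 is
ASIDE and NOT restated; no crux, rung or summit statement is proved; the Yang–Mills mass gap is NOT proved.  THEOREMS ONLY, no definition, no sorry.
[cite: BakryGentilLedoux2014, Thm 5.2.1]
-/

set_option autoImplicit false

noncomputable section

namespace Summit.QuantumFields.YangMills.Theorems.ColdStartUniversality

open MeasureTheory ProbabilityTheory Finset
open scoped NNReal ENNReal BigOperators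
open Literature.Probability.Process Literature.MathematicalPhysics.QuantumFieldTheory
open Literature.MathematicalPhysics.QuantumLattice (fundamentalRep fundamentalLatticeRep continuous_fundamentalRep)
open Literature.MathematicalPhysics.QuantumFieldTheory.Balaban1983to89

/-- ★★★ **(ULS) ⇒ pointwise-in-physical-time equilibration of block-averaged loop strings, threshold `2ε_K + log(C_K/δ)/(2c)`.**
[cite: BakryGentilLedoux2014, Thm 5.2.1] -/
theorem nearUniform_blockLoopString_physicalTime_of_uniformLogSobolev
    (hULS : ∃ γ₁ : ℝ, 0 < γ₁ ∧ ∀ (F : T3ContinuumYM3Torus.T3Family) (γ : ℝ), 0 < γ → γ ≤ γ₁ →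
      ∃ c : ℝ, 0 < c ∧ ∃ K₀ : ℕ, ∀ K : ℕ, K₀ ≤ K →
        ∀ (f : (Edge 3 ((F.P K).sitesPerDir 0) × Fin 2 × Fin 2 × Bool → ℝ) → ℝ), ContDiff ℝ 3 f →
        let coords : GaugeConfig 3 ((F.P K).sitesPerDir 0) (Matrix.specialUnitaryGroup (Fin 2) ℂ) →
            (Edge 3 ((F.P K).sitesPerDir 0) × Fin 2 × Fin 2 × Bool → ℝ) :=
          fun V q => (fun z : ℂ => if q.2.2.2 then z.im else z.re)
            ((fundamentalRep (Fin 2) (V q.1) : Matrix (Fin 2) (Fin 2) ℂ) q.2.1 q.2.2.1)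
        let gen : GaugeConfig 3 ((F.P K).sitesPerDir 0) (Matrix.specialUnitaryGroup (Fin 2) ℂ) → ℝ := fun V =>
          (∑ i : Edge 3 ((F.P K).sitesPerDir 0) × Fin 2 × Fin 2 × Bool, fderiv ℝ f (coords V) (Pi.single i 1) *
              (fun z : ℂ => if i.2.2.2 then z.im else z.re)
                ((latticeLangevinDynamics (fundamentalLatticeRep 2) ((γ * (F.P K).eps)⁻¹ / 2)).drift
                  (matrixConfig (fundamentalRep (Fin 2)) V) i.1 i.2.1 i.2.2.1) +
          1 / 2 * ∑ i : Edge 3 ((F.P K).sitesPerDir 0) × Fin 2 × Fin 2 × Bool,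
            ∑ j : Edge 3 ((F.P K).sitesPerDir 0) × Fin 2 × Fin 2 × Bool,
            fderiv ℝ (fun z => fderiv ℝ f z (Pi.single i 1)) (coords V) (Pi.single j 1) *
              ∑ n : Edge 3 ((F.P K).sitesPerDir 0) × NoiseIdx 2,
                (if n.1 = i.1 then (fun z : ℂ => if i.2.2.2 then z.im else z.re)
                  ((latticeLangevinDynamics (fundamentalLatticeRep 2) ((γ * (F.P K).eps)⁻¹ / 2)).noise
                    (matrixConfig (fundamentalRep (Fin 2)) V) i.1 n.2 i.2.1 i.2.2.1) else 0) *
                (if n.1 = j.1 then (fun z : ℂ => if j.2.2.2 then z.im else z.re)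
                  ((latticeLangevinDynamics (fundamentalLatticeRep 2) ((γ * (F.P K).eps)⁻¹ / 2)).noise
                    (matrixConfig (fundamentalRep (Fin 2)) V) j.1 n.2 j.2.1 j.2.2.1) else 0))
        c * (F.P K).eps *
            ((∫ V, f (coords V) ^ 2 * Real.log (f (coords V) ^ 2)
                ∂(wilsonMeasure (d := 3) (L := (F.P K).sitesPerDir 0) (fundamentalRep (Fin 2)) ((γ * (F.P K).eps)⁻¹ / 2))) -
              (∫ V, f (coords V) ^ 2
                ∂(wilsonMeasure (d := 3) (L := (F.P K).sitesPerDir 0) (fundamentalRep (Fin 2)) ((γ * (F.P K).eps)⁻¹ / 2))) *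
                Real.log (∫ V, f (coords V) ^ 2
                  ∂(wilsonMeasure (d := 3) (L := (F.P K).sitesPerDir 0) (fundamentalRep (Fin 2)) ((γ * (F.P K).eps)⁻¹ / 2)))) ≤
          -∫ V, f (coords V) * gen V
            ∂(wilsonMeasure (d := 3) (L := (F.P K).sitesPerDir 0) (fundamentalRep (Fin 2)) ((γ * (F.P K).eps)⁻¹ / 2))) :
    ∃ γ₁ : ℝ, 0 < γ₁ ∧ ∀ (F : T3ContinuumYM3Torus.T3Family) (γ : ℝ), 0 < γ → γ ≤ γ₁ →
      ∃ c : ℝ, 0 < c ∧ ∃ K₀ : ℕ, ∀ K : ℕ, K₀ ≤ K →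
        ∀ (B : Finset (Site 3 ((F.P K).sitesPerDir 0))), B.Nonempty →
        ∀ (m : ℕ) (i j : Fin m → Fin 3) (R T : Fin m → ℕ), 0 < ∑ k, (R k + T k) → ∀ δ : ℝ, 0 < δ →
        ∀ (z : GaugeConfig 3 ((F.P K).sitesPerDir 0) (Matrix.specialUnitaryGroup (Fin 2) ℂ))
          (Ω : Type) (mΩ : MeasurableSpace Ω) (P : Measure Ω) (hP : IsProbabilityMeasure P)
          (W : ℝ≥0 → Ω → (Edge 3 ((F.P K).sitesPerDir 0) × NoiseIdx 2 → ℝ)) (hW : IsFlatBrownian W P)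
          (U : ℝ≥0 → Ω → GaugeConfig 3 ((F.P K).sitesPerDir 0) (Matrix.specialUnitaryGroup (Fin 2) ℂ)),
          (∀ ω, U 0 ω = z) →
          (latticeLangevinDynamics (fundamentalLatticeRep 2) ((γ * (F.P K).eps)⁻¹ / 2)).IsSolution (fundamentalRep (Fin 2)) hW.natFiltration P W U →
          ∀ s : ℝ, 2 * (F.P K).eps ≤ s →
            2 * (F.P K).eps + Real.log (((∑ k : Fin m, ((R k : ℝ) + T k)) * Real.sqrt (16 * (366 * |((γ * (F.P K).eps)⁻¹ / 2)| + 3) * (((((F.P K).sitesPerDir 0) : ℕ) : ℝ) ^ 3 / (B.card : ℝ)) / (c * (F.P K).eps))) / δ) / (2 * c) ≤ s →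
            |(∫ ω, (∏ k : Fin m, (((B.card : ℝ))⁻¹ * ∑ x ∈ B, wilsonLoop (fundamentalRep (Fin 2)) x (i k) (j k) (R k) (T k) (U (s / (F.P K).eps).toNNReal ω))) ∂P) - ∫ V, (∏ k : Fin m, (((B.card : ℝ))⁻¹ * ∑ x ∈ B, wilsonLoop (fundamentalRep (Fin 2)) x (i k) (j k) (R k) (T k) V)) ∂(wilsonMeasure (d := 3) (L := ((F.P K).sitesPerDir 0)) (fundamentalRep (Fin 2)) ((γ * (F.P K).eps)⁻¹ / 2))| ≤ δ := by
  obtain ⟨γ₁, hγ₁, h⟩ := nearUniform_blockLoopString_coldStart_of_uniformLogSobolev hULS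
  refine ⟨γ₁, hγ₁, fun F γ hγ hγ1 => ?_⟩
  obtain ⟨c, hc, K₀, hK⟩ := h F γ hγ hγ1
  refine ⟨c, hc, K₀, fun K hKK B hB m i j R T hRT δ hδ z Ω mΩ P hP W hW U hU0 hU s h2 hs => ?_⟩
  have he : 0 < (F.P K).eps := (F.P K).eps_pos
  have hS : (0 : ℝ) < (B.card : ℝ) := by exact_mod_cast hB.card_pos
  have hRT' : (0 : ℝ) < (∑ k : Fin m, ((R k : ℝ) + T k)) := by
    have h' : ((∑ k, (R k + T k) : ℕ) : ℝ) = (∑ k : Fin m, ((R k : ℝ) + T k)) := by push_cast; rfl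
    rw [← h']; exact_mod_cast hRT
  have hLpos : (0 : ℝ) < (((((F.P K).sitesPerDir 0) : ℕ) : ℝ)) ^ 3 := by
    have : 0 < ((F.P K).sitesPerDir 0) := Nat.pos_of_ne_zero (NeZero.ne _)
    positivity
  have hcε : 0 < c * (F.P K).eps := mul_pos hc he
  obtain ⟨hsplit, hu⟩ := toNNReal_div_eq_two_add he h2
  rw [hsplit]
  have hb := hK K hKK B hB m i j R T hRT z Ω mΩ P hP W hW U hU0 hU (s / (F.P K).eps - 2).toNNReal
  refine hb.trans ?_
  obtain ⟨C, hC⟩ : ∃ C : ℝ, ((∑ k : Fin m, ((R k : ℝ) + T k)) * Real.sqrt (16 * (366 * |((γ * (F.P K).eps)⁻¹ / 2)| + 3) * (((((F.P K).sitesPerDir 0) : ℕ) : ℝ) ^ 3 / (B.card : ℝ)) / (c * (F.P K).eps))) = C := ⟨_, rfl⟩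
  rw [hC] at hs ⊢
  have hCpos : 0 < C := by
    rw [← hC]
    refine mul_pos hRT' (Real.sqrt_pos.2 ?_)
    refine div_pos (mul_pos (mul_pos (by norm_num) ?_) (div_pos hLpos hS)) hcε
    positivity
  have hu' : Real.log (C / δ) ≤ 2 * c * (s - 2 * (F.P K).eps) := by
    have h1 : Real.log (C / δ) / (2 * c) ≤ s - 2 * (F.P K).eps := by linarith
    rw [div_le_iff₀ (by positivity)] at h1
    linarith
  have hexp : Real.exp (-(2 * (c * (F.P K).eps)) * (((s / (F.P K).eps - 2).toNNReal : ℝ≥0) : ℝ)) ≤ δ / C := by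
    rw [hu]
    have e : -(2 * (c * (F.P K).eps)) * (s / (F.P K).eps - 2) = -(2 * c * (s - 2 * (F.P K).eps)) := by
      field_simp
    rw [e]
    have h1 : Real.exp (-(2 * c * (s - 2 * (F.P K).eps))) ≤ Real.exp (-Real.log (C / δ)) := Real.exp_le_exp.2 (by linarith)
    rw [Real.exp_neg (Real.log (C / δ)), Real.exp_log (div_pos hCpos hδ), inv_div] at h1
    exact h1
  calc Real.exp (-(2 * (c * (F.P K).eps)) * (((s / (F.P K).eps - 2).toNNReal : ℝ≥0) : ℝ)) * C ≤ δ / C * C :=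
        mul_le_mul_of_nonneg_right hexp hCpos.le
    _ = δ := div_mul_cancel₀ δ hCpos.ne'

/-- ★ **The block threshold is `O(log(1/ε_K))`**: for `0 < ε ≤ 1`, `0 < γ`, `γε ≤ 1`, `c, δ, A, N > 0`,
`2ε + log(A√(16(366·|(γε)⁻¹/2|+3)·N/(cε))/δ)/(2c) ≤ 2 + (log(A/δ) + log(2976N/(γc))/2)/(2c) + log(1/ε)/(2c)`
(`16(183/(γε)+3) ≤ 16·186/(γε)`, `√(2976N/(γcε²)) = √(2976N/(γc))/ε`). [folklore] -/
theorem nearUniform_blockThreshold_le_log {γ c ε δ A N : ℝ} (hγ : 0 < γ) (hc : 0 < c) (hε : 0 < ε) (hε1 : ε ≤ 1) (hγε : γ * ε ≤ 1)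
    (hδ : 0 < δ) (hA : 0 < A) (hN : 0 < N) :
    2 * ε + Real.log ((A * Real.sqrt (16 * (366 * |(γ * ε)⁻¹ / 2| + 3) * N / (c * ε))) / δ) / (2 * c) ≤
      2 + (Real.log (A / δ) + Real.log (2976 * N / (γ * c)) / 2) / (2 * c) + Real.log (1 / ε) / (2 * c) := by
  have hγε0 : 0 < γ * ε := mul_pos hγ hε
  have habs : |(γ * ε)⁻¹ / 2| = (γ * ε)⁻¹ / 2 := abs_of_pos (by positivity)
  have hγ0 : γ ≠ 0 := hγ.ne'
  have hc0 : c ≠ 0 := hc.ne'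
  have hε0 : ε ≠ 0 := hε.ne'
  have hin : 16 * (366 * |(γ * ε)⁻¹ / 2| + 3) * N / (c * ε) ≤ 2976 * N / (γ * c) / ε ^ 2 := by
    rw [habs]
    have e1 : 16 * (366 * ((γ * ε)⁻¹ / 2) + 3) * N / (c * ε) = 16 * (183 + 3 * (γ * ε)) * N / (γ * c * ε ^ 2) := by
      field_simp
      ring
    have e2 : 2976 * N / (γ * c) / ε ^ 2 = 16 * 186 * N / (γ * c * ε ^ 2) := by
      rw [div_div]
      norm_num
    rw [e1, e2]
    apply div_le_div_of_nonneg_right _ (by positivity)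
    nlinarith [hγε, hN]
  have hsq : Real.sqrt (16 * (366 * |(γ * ε)⁻¹ / 2| + 3) * N / (c * ε)) ≤ Real.sqrt (2976 * N / (γ * c)) / ε := by
    calc Real.sqrt (16 * (366 * |(γ * ε)⁻¹ / 2| + 3) * N / (c * ε)) ≤ Real.sqrt (2976 * N / (γ * c) / ε ^ 2) := Real.sqrt_le_sqrt hin
      _ = Real.sqrt (2976 * N / (γ * c)) / ε := by rw [Real.sqrt_div' _ (by positivity), Real.sqrt_sq hε.le]
  have hpos1 : 0 < A * Real.sqrt (16 * (366 * |(γ * ε)⁻¹ / 2| + 3) * N / (c * ε)) := by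
    rw [habs]; positivity
  have hpos2 : 0 < Real.sqrt (2976 * N / (γ * c)) := Real.sqrt_pos.2 (by positivity)
  have hlog : Real.log ((A * Real.sqrt (16 * (366 * |(γ * ε)⁻¹ / 2| + 3) * N / (c * ε))) / δ) ≤
      Real.log (A / δ) + Real.log (2976 * N / (γ * c)) / 2 + Real.log (1 / ε) := by
    have h1 : Real.log ((A * Real.sqrt (16 * (366 * |(γ * ε)⁻¹ / 2| + 3) * N / (c * ε))) / δ) ≤ Real.log ((A * (Real.sqrt (2976 * N / (γ * c)) / ε)) / δ) :=
      Real.log_le_log (div_pos hpos1 hδ) (div_le_div_of_nonneg_right (mul_le_mul_of_nonneg_left hsq hA.le) hδ.le)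
    have e : Real.log ((A * (Real.sqrt (2976 * N / (γ * c)) / ε)) / δ) = Real.log (A / δ) + Real.log (2976 * N / (γ * c)) / 2 + Real.log (1 / ε) := by
      have e1 : (A * (Real.sqrt (2976 * N / (γ * c)) / ε)) / δ = (A / δ) * Real.sqrt (2976 * N / (γ * c)) * (1 / ε) := by
        field_simp
      rw [e1, Real.log_mul (by positivity) (by positivity), Real.log_mul (by positivity) hpos2.ne', Real.log_sqrt (by positivity)]
    linarith
  have h2c : 0 < 2 * c := by positivity
  have hdiv := div_le_div_of_nonneg_right hlog h2c.le
  have e3 : (Real.log (A / δ) + Real.log (2976 * N / (γ * c)) / 2 + Real.log (1 / ε)) / (2 * c) =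
      (Real.log (A / δ) + Real.log (2976 * N / (γ * c)) / 2) / (2 * c) + Real.log (1 / ε) / (2 * c) := by ring
  rw [e3] at hdiv
  linarith

end Summit.QuantumFields.YangMills.Theorems.ColdStartUniversality
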